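import Literature.NumberTheory.GaloisRepresentations.PadicEmbeddingCompletion
import Literature.NumberTheory.GaloisRepresentations.PadicAlgebraOfLocalField
import Literature.NumberTheory.EllipticCurves.AnticyclotomicSignedLocalConditions
import HarnessLib

/-!
# Coherent `p`-adic frames: for a place `v ∣ p` that does not split in a `ℤ_p`-extension `K_∞/K`, a complex embedding `ιC` of `K̄`
# and a transport `e : ℚ̄_p ≃ ℂ` whose pull-back `e⁻¹ ∘ ιC|_K` induces `v`, there is a ring map `Φ : K̄_v → ℚ̄_p` over `ℚ_p → K_v`
# with `e ∘ Φ ∘ closureEmb = ιC` on `K_∞` (Neukirch II (8.1): embeddings vs places; Serre II §1.1: change of decomposition embedding)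

Topic `NumberTheory/GaloisRepresentations`; namespace `Literature.NumberTheory.GaloisRepresentations.PadicEmbedding`. THEOREMS ONLY (kernel lane);
no named fact, no definition, no instance, no `sorry`. Cell `pub/bsd-wall` / `bsd-inputs`, seat `bsd-inputs-honda-p1` g31: this discharges the ONE
frame hypothesis of `Kato2004.CM.prop159_ellipticUnits_tatePairing_values_inert` (file `Kato2004/EllipticUnitTatePairingValuesK.lean`, flag `frames`)
that a consumer cannot meet by `rfl`/`inferInstance` — the existence of a `p`-adic frame `Φ` of `K̄_v` over `ℚ_p` COHERENT through `e` with a given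
complex frame `ιC` on the cyclotomic tower `K_∞` — for crux L `SmallImageLowerHalfBothSigns` (stmt-BirchSwinnertonDyer-23599), row S4‴ (THE MATCH).
Construction: `τ := e⁻¹ ∘ ιC|_K : K → ℚ̄_p` has a place `v_τ ∣ p` and a continuous extension `τ̂ : K_{v_τ} → ℚ̄_p` (`PadicEmbedding.lift`); when
`v_τ = v` (automatic if `v` is the ONLY place above `p`, `place_eq_of_asIdeal_eq_span`), extend `τ̂` to `K̄_v` (`IsAlgClosed.lift`), compare the two
complex frames `e ∘ Φ₀ ∘ closureEmb` and `ιC` of the normal extension `K̄/K` — they differ by `τ₀ ∈ Γ_K` (`AlgHom.restrictNormal'`) — and absorb `τ₀`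
on `K_∞` by an element `g ∈ Γ_{K_v}` with `κ(res_v g) = κ(τ₀)` (`IsNonsplitIn κ v` = surjectivity of `κ ∘ res_v`). HONEST FRAMING: field-theoretic
plumbing; nothing about BSD is proved.
References: [NeukirchANT1999] Ch. II (8.1)–(8.3); [SerreGaloisCohomology1997] II §1.1.
-/

noncomputable section

open scoped NumberField
open NumberField IsDedekindDomain IsDedekindDomain.HeightOneSpectrum Field

namespace Literature.NumberTheory.GaloisRepresentations

namespace PadicEmbedding

open Literature.NumberTheory.EllipticCurves Literature.NumberTheory.EllipticCurves.AcSigned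

variable {K : Type} [Field K] [NumberField K] {p : ℕ} [Fact p.Prime]

/-- If `v` is THE prime of `K` above `p` (`v = (p)`, e.g. `p` inert in a quadratic field) then the place of every `p`-adic embedding
`τ : K → ℚ̄_p` is `v`. [cite: NeukirchANT1999, Ch. II Prop. (8.2)] -/
theorem place_eq_of_asIdeal_eq_span (τ : K →+* PadicAlgCl p) (v : HeightOneSpectrum (𝓞 K))
    (hv : v.asIdeal = Ideal.span {((p : ℕ) : 𝓞 K)}) : place τ = v := by
  refine HeightOneSpectrum.ext ?_
  have hle : v.asIdeal ≤ (place τ).asIdeal := by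
    rw [hv, Ideal.span_singleton_le_iff_mem]
    exact natCast_mem_place τ
  exact ((v.isPrime.isMaximal v.ne_bot).eq_of_le (place τ).isPrime.ne_top hle).symm

/-- A continuous ring map `K_v → ℚ̄_p` is compatible with the canonical `ℚ_p`-structures (`LocalField.adicCompletionPadicAlgebra` on `K_v`, the
inclusion `ℚ_p ⊂ ℚ̄_p`): both composites `ℚ_p → ℚ̄_p` are continuous ring maps agreeing on the dense `ℚ`. [cite: NeukirchANT1999, Ch. II Thm. (8.1)] -/
theorem map_algebraMap_padic_of_continuous (v : HeightOneSpectrum (𝓞 K)) (hpv : ((p : ℕ) : 𝓞 K) ∈ v.asIdeal)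
    (Φv : v.adicCompletion K →+* PadicAlgCl p) (hΦv : Continuous Φv) (y : ℚ_[p]) :
    letI := LocalField.adicCompletionPadicAlgebra v p hpv
    Φv (algebraMap ℚ_[p] (v.adicCompletion K) y) = algebraMap ℚ_[p] (PadicAlgCl p) y := by
  letI := LocalField.adicCompletionPadicAlgebra v p hpv
  have h1 : Continuous fun y : ℚ_[p] => Φv (algebraMap ℚ_[p] (v.adicCompletion K) y) :=
    hΦv.comp (LocalField.continuous_algebraMap_adicCompletionPadicAlgebra v p hpv)
  have h2 : Continuous fun y : ℚ_[p] => algebraMap ℚ_[p] (PadicAlgCl p) y := continuous_algebraMap ℚ_[p] (PadicAlgCl p)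
  refine congrFun ((Padic.denseRange_ratCast p).equalizer h1 h2 (funext fun q => ?_)) y
  simp only [Function.comp_apply, map_ratCast]

/-- ★ **A `p`-adic frame of `K̄_v` over `ℚ_p`, coherent with a given complex frame of `K̄` on the `ℤ_p`-tower `K_∞` through `e : ℚ̄_p ≃ ℂ`**, exists as soon
as `v = (p)` is the prime above `p` and `v` does not split in `K_∞/K`: `∃ Φ : K̄_v →+* ℚ̄_p`, `Φ ∘ (ℚ_p → K_v → K̄_v) = (ℚ_p ⊂ ℚ̄_p)` and
`e (Φ (closureEmb x)) = ιC x` for every `x ∈ K_∞ = K̄^{ker κ}`. (The hypothesis `ιC|_K = σK` fixes the complex frame on `K`; `Φ|_K` is then `e⁻¹ ∘ σK`.)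
[cite: NeukirchANT1999, Ch. II Thm. (8.1)] [cite: SerreGaloisCohomology1997, II §1.1] -/
theorem exists_frame_coherent_on_zpTower (v : HeightOneSpectrum (𝓞 K)) (hv : v.asIdeal = Ideal.span {((p : ℕ) : 𝓞 K)})
    (hpv : ((p : ℕ) : 𝓞 K) ∈ v.asIdeal) (κ : ZpExtension K p) (hvns : IsNonsplitIn κ v) (σK : K →+* ℂ) (e : PadicAlgCl p ≃+* ℂ)
    (ιC : AlgebraicClosure K →+* ℂ) (hιC : ∀ x : K, ιC (algebraMap K (AlgebraicClosure K) x) = σK x) :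
    ∃ Φ : AlgebraicClosure (v.adicCompletion K) →+* PadicAlgCl p,
      (letI := LocalField.adicCompletionPadicAlgebra v p hpv
       ∀ y : ℚ_[p], Φ (algebraMap (v.adicCompletion K) (AlgebraicClosure (v.adicCompletion K)) (algebraMap ℚ_[p] (v.adicCompletion K) y)) =
         algebraMap ℚ_[p] (PadicAlgCl p) y) ∧
      ∀ x : AlgebraicClosure K, (∀ σ ∈ κ.kerSubgroup, σ • x = x) →
        e (Φ (closureEmb (K := K) (v.adicCompletion K) x)) = ιC x := by
  -- the `p`-adic embedding of `K` and its place
  set τ : K →+* PadicAlgCl p := (e.symm : ℂ →+* PadicAlgCl p).comp σK with hτ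
  have hpl : place τ = v := place_eq_of_asIdeal_eq_span τ v hv
  subst hpl
  -- Step 1: the continuous extension to `K_v` and a further extension to `K̄_v`
  set Kv := (place τ).adicCompletion K
  let Φv : Kv →+* PadicAlgCl p := lift τ
  letI algv : Algebra Kv (PadicAlgCl p) := Φv.toAlgebra
  let Φ₀ : AlgebraicClosure Kv →ₐ[Kv] PadicAlgCl p := IsAlgClosed.lift
  have hΦ₀v : ∀ z : Kv, Φ₀ (algebraMap Kv (AlgebraicClosure Kv) z) = Φv z := fun z => Φ₀.commutes z
  -- Step 2: the complex frame `ι₁ = e ∘ Φ₀ ∘ closureEmb` extends `σK`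
  let ι₁ : AlgebraicClosure K →+* ℂ := (e : PadicAlgCl p →+* ℂ).comp (Φ₀.toRingHom.comp (closureEmb (K := K) Kv).toRingHom)
  have hι₁ : ∀ x : K, ι₁ (algebraMap K (AlgebraicClosure K) x) = σK x := by
    intro x
    change e (Φ₀ (closureEmb (K := K) Kv (algebraMap K (AlgebraicClosure K) x))) = σK x
    rw [AlgHom.commutes, IsScalarTower.algebraMap_apply K Kv (AlgebraicClosure Kv), hΦ₀v, lift_algebraMap]
    change e (e.symm (σK x)) = σK x
    exact e.apply_symm_apply _
  -- Step 3: the two complex frames of the normal extension `K̄/K` differ by `τ₀ ∈ Γ_K`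
  letI algKC : Algebra K ℂ := σK.toAlgebra
  letI algKbarC : Algebra (AlgebraicClosure K) ℂ := ι₁.toAlgebra
  haveI : IsScalarTower K (AlgebraicClosure K) ℂ := IsScalarTower.of_algebraMap_eq fun x => (hι₁ x).symm
  let ιCa : AlgebraicClosure K →ₐ[K] ℂ := { ιC with commutes' := fun x => hιC x }
  let τ₀ : absoluteGaloisGroup K := ιCa.restrictNormal' (AlgebraicClosure K)
  have hτ₀ : ∀ x : AlgebraicClosure K, ι₁ (τ₀ • x) = ιC x := fun x => by
    change algebraMap (AlgebraicClosure K) ℂ (ιCa.restrictNormal (AlgebraicClosure K) x) = ιCa (algebraMap _ _ x)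
    exact AlgHom.restrictNormal_commutes ιCa (AlgebraicClosure K) x
  -- Step 4: absorb `τ₀` on `K_∞` by a local element `g`
  obtain ⟨g, hg⟩ := hvns (κ τ₀)
  have hg' : κ (resGal (K := K) Kv g) = κ τ₀ := hg
  refine ⟨Φ₀.toRingHom.comp ((show AlgebraicClosure Kv ≃ₐ[Kv] AlgebraicClosure Kv from g) : AlgebraicClosure Kv →+* AlgebraicClosure Kv), ?_, ?_⟩
  · intro y
    change Φ₀ ((show AlgebraicClosure Kv ≃ₐ[Kv] AlgebraicClosure Kv from g) (algebraMap Kv (AlgebraicClosure Kv) _)) = _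
    rw [AlgEquiv.commutes, hΦ₀v]
    exact map_algebraMap_padic_of_continuous (place τ) hpv Φv (continuous_lift τ) y
  · intro x hx
    change e (Φ₀ ((show AlgebraicClosure Kv ≃ₐ[Kv] AlgebraicClosure Kv from g) (closureEmb (K := K) Kv x))) = ιC x
    have hmove : (show AlgebraicClosure Kv ≃ₐ[Kv] AlgebraicClosure Kv from g) (closureEmb (K := K) Kv x) =
        closureEmb (K := K) Kv ((resGal (K := K) Kv g) • x) := by
      rw [resGal_eq, resGalOfEmb_apply]
      exact (apply_resGalAuxOfEmb_apply (closureEmb (K := K) Kv) g x).symm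
    have hfix : (resGal (K := K) Kv g) • x = τ₀ • x := by
      have hmem : τ₀⁻¹ * resGal (K := K) Kv g ∈ κ.kerSubgroup := by
        rw [ZpExtension.mem_kerSubgroup, map_mul, map_inv, hg', inv_mul_cancel]
      have := hx _ hmem
      rw [mul_smul] at this
      calc (resGal (K := K) Kv g) • x = τ₀ • (τ₀⁻¹ • ((resGal (K := K) Kv g) • x)) := by rw [smul_inv_smul]
        _ = τ₀ • x := by rw [this]
    rw [hmove, hfix]
    exact hτ₀ x

end PadicEmbedding

end Literature.NumberTheory.GaloisRepresentations

end
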